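import Summits.BirchSwinnertonDyer.BirchSwinnertonDyer.Theorems.CMKolyvaginAtInertTwoRationalDescentAtTwoClosed
import Summits.BirchSwinnertonDyer.BirchSwinnertonDyer.Theorems.CMKolyvaginAtInertTwoRationalDescentAtTwoCount
import Summits.BirchSwinnertonDyer.BirchSwinnertonDyer.Theorems.GenusKolyvaginAtTwoEquivariantKolyvaginExactAtTwoArchimedeanVanishingNegDisc
import Literature.NumberTheory.EllipticCurves.ArchimedeanLocalConditionTorsion
import HarnessLib

/-!
# Route `CMKolyvaginAtInertTwo`, crux `CMKolyvaginExactAtInertTwo` (stmt-BirchSwinnertonDyer-24277):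
# THE `M₀ = 0` CASE ON H₂ FOR A PRIME HEEGNER FIELD — `y_K ∉ 2E(K)` ⟹ `Sel₂(E/K) ⊆ {0, δ₂ y_K}`
# modulo Poitou–Tate (two named print facts + the over-`ℚ` reciprocity binder) and the local descent binder

Seat `bsd-line-cmk2-p1` g8 (cell `bsd-print-cf2`); helper (`--supports stmt-BirchSwinnertonDyer-24277`);
sixth file of the over-`ℚ` bit: `…RationalDescentAtTwoClosed` (p629711) with its binder (lag) DISCHARGED by
`…RationalDescentAtTwoCount.ratDescent_lag_of_discr_eq_neg_prime` (one-place Poitou–Tate count, modulo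
the PRINT named facts `poitouTate_selmerStructure_duality_real ℚ` — Milne ADT I.4.10 — and
`localEulerPoincareCharacteristic` — Tate, Milne I.2.8 — and `#E(ℚ_q)[2] = 2` for a prime Heegner field,
gk2-p5), and the ARCHIMEDEAN half of (desc-loc) DISCHARGED (`Δ_E < 0` ⟹ `H¹(ℚ_∞, E) = 0`, gk2-p3's
`ArchVanishing.localRestrictionKer_infinitePlace_eq_top_of_Δ_neg`, pulled back to level `2` by the tree's
`mem_selmerLocalKer_iff_torsionH1ToH1_mem`). THEOREMS ONLY; no item is closed; BSD is not proved by this.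

* `selmer_two_eq_zero_or_eq_kummer_of_cmInert_prime_discr` — `E/ℚ` with `HasCM`, `2` inert in
  `F = Frac End E`, `ρ̄_{E,2}` onto; `K = ℚ(√−q)` imaginary quadratic with `d_K = −q` odd, `q` prime, Heegner
  for `N_E`, conjugation `c ≠ 1`; `P = y_K` a Heegner point of level `N_E` with `P ∉ 2E(K)`; ty2's CM-inert
  Kolyvagin-system data `D`, `R` at `p = 2`; `u` the place of `ℚ` over `q`. GIVEN the two Poitou–Tate print
  facts and the two remaining over-`ℚ` binders — (desc-fin): a class of `H¹(ℚ, E[2])` whose restriction is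
  Selmer over `K` satisfies the Selmer condition over `ℚ` at every FINITE place `≠ u` [inflation at split
  places, `H¹(K_w/ℚ_v, E(K_w)) = 0` at unramified good `v` incl. `2` (Milne I.3.8)] — the infinite place is
  discharged here;
  (dual): for a Kolyvagin prime `ℓ` and a `τ`-invariant class `d ∈ H¹(K, E[2])` Selmer off `λ` and not
  Selmer at `λ`, every relaxed `ξ ∈ H¹(ℚ, E[2])` strict at `u` has `(res ξ)_λ = 0` [Poitou–Tate over `ℚ` for
  `(ξ, κ)`, `res κ = d`, with local duality at `ℓ`: `H¹_ur(ℚ_ℓ, E[2]) ≅ ℤ/2` self-annihilating] — every class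
  of `Sel₂(E/K)` is `0` or `δ₂ y_K`. Hence `E(K)/2E(K) = ⟨y_K⟩`, `Ш(E/K)[2] = 0`, `#Ш(E/K)[2^∞] = 4⁰`: the
  `M₀ = 0` case of the crux, modulo exactly: the `p = 2` Kolyvagin data (`D`, `R`), `chebotarev_artinRep`
  (via g3's leaf), the two Poitou–Tate print facts, (desc-fin) and (dual).

References: [GrossLMS1991] §§5–6, §10; [McCallumLMS1991] §§2–3, §5; [MilneADT2006] I Thm. 2.8, Prop. 3.8,
Thm. 4.10; [MazurRubin2010] Lemma 3.2, Prop. 3.3; [Kolyvagin1989Izv] §3.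
-/

-- single-conjunct summit: `Summit.BirchSwinnertonDyer.BirchSwinnertonDyer.…` repeats the name by design
set_option linter.dupNamespace false
set_option autoImplicit false

noncomputable section

open scoped Classical
open WeierstrassCurve NumberField IsDedekindDomain Field
open Literature.NumberTheory.GaloisRepresentations Literature.NumberTheory.EllipticCurves
open Literature.NumberTheory.GaloisCohomology
open Rat.HeightOneSpectrum (primesEquiv)

namespace Summit.BirchSwinnertonDyer.BirchSwinnertonDyer.Theorems.KolyvaginRatDescentTwo

variable (W : WeierstrassCurve ℚ) {K : Type} [Field K] [NumberField K]

/-- **`Δ_E < 0` ⟹ no archimedean condition at level `n`**: every class of `H¹(ℚ, E[n])` satisfies the Selmer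
local condition at the infinite place of `ℚ` (`H¹(ℚ_∞, E) = 0`, gk2-p3's `ArchVanishing`, pulled back along
`H¹(ℚ, E[n]) → H¹(ℚ, E)`). [cite: GrossLMS1991, §6 (proof of Prop. 6.2 (1))] [cite: MilneADT2006, I Rem. 3.7] -/
theorem mem_selmerLocalKer_infinitePlace_of_Δ_neg [W.IsElliptic] (hΔ : W.Δ < 0) {n : ℤ}
    (w : InfinitePlace ℚ) (ξ : galH1Torsion W n) : ξ ∈ selmerLocalKer W w.Completion n := by
  rw [WeierstrassCurve.mem_selmerLocalKer_iff_torsionH1ToH1_mem,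
    GenusExact.ArchVanishing.localRestrictionKer_infinitePlace_eq_top_of_Δ_neg W w hΔ]
  exact AddSubgroup.mem_top _

/-- **ON H₂ with a prime Heegner field: `y_K ∉ 2E(K)` ⟹ `Sel₂(E/K) ⊆ {0, δ₂ y_K}`** modulo the two
Poitou–Tate print facts, (desc-fin) and (dual) — see the module docstring. [cite: GrossLMS1991, Prop. 2.1
with §10, Props. 5.4, 6.2] [cite: McCallumLMS1991, §2 Prop. 2.2, §3 Cor. 3.2, §5 Lemma 5.3]
[cite: MilneADT2006, Ch. I, Thm. 2.8 and Thm. 4.10] [cite: Kolyvagin1989Izv, §3] -/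
theorem selmer_two_eq_zero_or_eq_kummer_of_cmInert_prime_discr [W.IsElliptic] [W.IsGloballyMinimal]
    [NeZero (W.conductorNorm ℤ)] (hCM : W.HasCM)
    (hin : Literature.NumberTheory.EllipticCurves.Rank1Residual.CMInert W 2)
    (hsurj : W.HasSurjectiveModNGaloisRep 2) (hK : IsImaginaryQuadratic K) (hodd : Odd (discr K))
    (hH : SatisfiesHeegnerHypothesis (W.conductorNorm ℤ) K) {q : ℕ} (hq : q.Prime)
    (hd : discr K = -(q : ℤ)) (u : HeightOneSpectrum (𝓞 ℚ)) (hu : ((primesEquiv u : Nat.Primes) : ℕ) = q)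
    (hPT : poitouTate_selmerStructure_duality_real ℚ)
    (hEP : ∀ v : HeightOneSpectrum (𝓞 ℚ), localEulerPoincareCharacteristic (v.adicCompletion ℚ))
    {P : (W.baseChange K).toAffine.Point} (hP : IsHeegnerPoint (W.conductorNorm ℤ) W K P)
    {c : K ≃ₐ[ℚ] K} (hc : c ≠ 1) (hy : ∀ Q : (W.baseChange K).toAffine.Point, 2 • Q ≠ P)
    (D : Rank1Residual.P2.KolyvaginMachine.PointSystemFamily (W.conductorNorm ℤ) W K P 2
      (Literature.NumberTheory.EllipticCurves.Rank1Residual.CMInert W))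
    (R : Rank1Residual.P2.KolyvaginMachine.ReciprocityFamily (W.conductorNorm ℤ) W K 2
      (Literature.NumberTheory.EllipticCurves.Rank1Residual.CMInert W))
    (hdiv : ∀ Q : geomPoints (W.baseChange K), ∃ R, ((2 ^ 1 : ℕ) : ℤ) • R = Q)
    (hdescfin : ∀ s ∈ selmerGroup (W.baseChange K) ((2 ^ 1 : ℕ) : ℤ),
      ∀ ξ : galH1Torsion W ((2 ^ 1 : ℕ) : ℤ), resTorsion W K ((2 ^ 1 : ℕ) : ℤ) ξ = s →
        ∀ v : HeightOneSpectrum (𝓞 ℚ), v ≠ u →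
          ξ ∈ selmerLocalKer W (v.adicCompletion ℚ) ((2 ^ 1 : ℕ) : ℤ))
    (hdual : ∀ {ℓ : ℕ} (hℓ : IsKolyvaginPrime (W.conductorNorm ℤ) W K 2 ℓ),
      FrobEqFrobInfty W K (2 ^ 1) ℓ →
      ∀ d : galH1Torsion (W.baseChange K) ((2 ^ 1 : ℕ) : ℤ), conjAct W c ((2 ^ 1 : ℕ) : ℤ) d = d →
      (∀ v : HeightOneSpectrum (𝓞 K), (ℓ : 𝓞 K) ∉ v.asIdeal →
        d ∈ selmerLocalKer (W.baseChange K) (v.adicCompletion K) ((2 ^ 1 : ℕ) : ℤ)) →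
      (∀ w : InfinitePlace K, d ∈ selmerLocalKer (W.baseChange K) w.Completion ((2 ^ 1 : ℕ) : ℤ)) →
      d ∉ selmerLocalKer (W.baseChange K) (hℓ.place.adicCompletion K) ((2 ^ 1 : ℕ) : ℤ) →
      ∀ ξ : galH1Torsion W ((2 ^ 1 : ℕ) : ℤ),
      ((∀ v : HeightOneSpectrum (𝓞 ℚ), v ≠ u →
          ξ ∈ selmerLocalKer W (v.adicCompletion ℚ) ((2 ^ 1 : ℕ) : ℤ)) ∧
          ∀ w : InfinitePlace ℚ, ξ ∈ selmerLocalKer W w.Completion ((2 ^ 1 : ℕ) : ℤ)) →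
      ξ ∈ W.torsionLocalKer (u.adicCompletion ℚ) ((2 ^ 1 : ℕ) : ℤ) →
      resTorsion W K ((2 ^ 1 : ℕ) : ℤ) ξ ∈
        (W.baseChange K).torsionLocalKer (hℓ.place.adicCompletion K) ((2 ^ 1 : ℕ) : ℤ)) :
    ∀ s ∈ selmerGroup (W.baseChange K) ((2 ^ 1 : ℕ) : ℤ),
      s = 0 ∨ s = kummerMapTorsion (W.baseChange K) ((2 ^ 1 : ℕ) : ℤ) hdiv P := by
  have hΔ : W.Δ < 0 := KolyvaginEigenTwo.Δ_neg_of_cmInert_two W hCM hin hsurj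
  -- (lag), discharged: the one-place count at `u` with `#E(ℚ_q)[2] = 2`
  have hlag := ratDescent_lag_of_discr_eq_neg_prime W u hPT hEP hΔ hK hodd hH hq hd hu
  -- (desc-loc) = (desc-fin) + the archimedean place, discharged
  have hdescloc : ∀ s ∈ selmerGroup (W.baseChange K) ((2 ^ 1 : ℕ) : ℤ),
      ∀ ξ : galH1Torsion W ((2 ^ 1 : ℕ) : ℤ), resTorsion W K ((2 ^ 1 : ℕ) : ℤ) ξ = s →
        (∀ v : HeightOneSpectrum (𝓞 ℚ), v ≠ u →
            ξ ∈ selmerLocalKer W (v.adicCompletion ℚ) ((2 ^ 1 : ℕ) : ℤ)) ∧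
          ∀ w : InfinitePlace ℚ, ξ ∈ selmerLocalKer W w.Completion ((2 ^ 1 : ℕ) : ℤ) :=
    fun s hs ξ hξ ↦ ⟨hdescfin s hs ξ hξ, fun w ↦ mem_selmerLocalKer_infinitePlace_of_Δ_neg W hΔ w ξ⟩
  exact selmer_two_eq_zero_or_eq_kummer_of_cmInert_rat W hCM hin hsurj hK hH hP hc hy D R hdiv u hdescloc
    hdual hlag

end Summit.BirchSwinnertonDyer.BirchSwinnertonDyer.Theorems.KolyvaginRatDescentTwo

end
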